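import Literature.Computability.Complexity.StackUnary
import Literature.Computability.Cryptography.LiuPassDistProgram
import Mathlib.Data.Nat.Size
import HarnessLib

/-!
# The preprocessing of Liu–Pass's one-way function candidate is polynomial time (a stack program)

Trunk `CplxCore` toolkit entry (structured stack programs `Com`, `Com.mem_FP`; unary bricks of
`StackUnary.lean`), serving the efficiency fact `Literature.Computability.Cryptography.liuPassOWF_polyTimeComputable`
of `LiuPassWeakOWF.lean` (Liu–Pass, FOCS 2020, proof of Thm 4.1; discharged in
`LiuPassWeakOWFProofs.lean`). The candidate is, on `x` of length `L` with `D = Nat.size L`,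
`ℓ = x ↾ D` (a length field, value `v = bitsToNat ℓ`), `Π = (x ⇂ D) ↾ v` and
`s = t(L - D - c)`:  `f(x) = ⟨1ᴸ, ⟨ℓ, U(Π, 1ˢ)⟩⟩`. Everything except the call of the universal
machine `U` is computed here by **one stack program** `LPO.prog t c`, whose output
`⟨⟨1ᴸ, ℓ⟩, ⟨Π, 1ˢ⟩⟩` presents the query `⟨Π, 1ˢ⟩` to `U` in its second component (budget in unary,
the input convention of `UniversalMachine.polyTime`):

* `lpoFn t c ∈ FP` (`lpoFn_mem_FP`), `lpoFn t c x = ⟨⟨1ᴸ, ℓ⟩, ⟨Π, 1ˢ⟩⟩` (`lpoFn_apply`, with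
  `Nat.size L = ⌊log₂ L⌋ + 1` for `L ≥ 1`, `size_eq_log_succ`).

Phases (registers `LPO.Rg`): `scan` (four unary copies of `L`, `x` restored); `logCount` of
`StackUnary.lean` (`⌊log₂ L⌋` halvings with fuel `L`) and `sizeFix` (`+1` iff `x ≠ []`);
`fldLoop` (read the `D` field bits least significant first, accumulating `v` in unary with a
running power of two: `addReg`, `dblReg`); `takeN` (the program `Π`); `popK` (`L - D - c`);
`hornerProg` (`s = t(L - D - c)` in unary); `output`. All quantities are `O(L)` or `t(O(L))`
(`2^D ≤ 2L + 1`), the cost is bounded by `LPO.timePoly t c = 64 (X + t(X+1) + deg t + c + 2)³`.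

## References

* Y. Liu, R. Pass, *On one-way functions and Kolmogorov complexity*, FOCS 2020
  (arXiv:2009.11514), §2.2 and proof of Thm 4.1 (the candidate `f(ℓ ‖ Π') = ℓ ‖ U(Π, 1^{t(n)})`).
* S. Arora, B. Barak, *Computational Complexity: A Modern Approach*, CUP 2009, §1.3, Thm. 2.8.
* T. Nipkow, G. Klein, *Concrete Semantics*, Springer 2014, Ch. 7–8 (big-step verification style).
-/

namespace Literature.Computability.Cryptography

open _root_.Computability

namespace LPO

open Complexity.Com Complexity.SProg

/-- Registers: input; fuel, value, `L - D - c`, and output copies of `L`; the field width `D`;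
the field bits; its value `v`; the running power of two; Horner accumulator, buffer, scratch; the
program `Π`; output. [folklore] -/
inductive Rg
  | inp | l1 | l2 | l3 | l4 | dd | fl | vv | pw | acc | acc2 | tmp | pg | out
  deriving DecidableEq, Fintype

/-- Explicit register files. [folklore] -/
def mk (zi z1 z2 z3 z4 zd zf zv zp za za2 zt zg zo : List Bool) : Complexity.Regs Rg := fun r =>
  match r with
  | .inp => zi | .l1 => z1 | .l2 => z2 | .l3 => z3 | .l4 => z4 | .dd => zd | .fl => zf | .vv => zv
  | .pw => zp | .acc => za | .acc2 => za2 | .tmp => zt | .pg => zg | .out => zo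

section MkLemmas

variable (zi z1 z2 z3 z4 zd zf zv zp za za2 zt zg zo x : List Bool)

/-- Reading `inp`. [folklore] -/
@[simp] theorem mk_inp : mk zi z1 z2 z3 z4 zd zf zv zp za za2 zt zg zo .inp = zi := rfl
/-- Reading `l1`. [folklore] -/
@[simp] theorem mk_l1 : mk zi z1 z2 z3 z4 zd zf zv zp za za2 zt zg zo .l1 = z1 := rfl
/-- Reading `l2`. [folklore] -/
@[simp] theorem mk_l2 : mk zi z1 z2 z3 z4 zd zf zv zp za za2 zt zg zo .l2 = z2 := rfl
/-- Reading `l3`. [folklore] -/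
@[simp] theorem mk_l3 : mk zi z1 z2 z3 z4 zd zf zv zp za za2 zt zg zo .l3 = z3 := rfl
/-- Reading `l4`. [folklore] -/
@[simp] theorem mk_l4 : mk zi z1 z2 z3 z4 zd zf zv zp za za2 zt zg zo .l4 = z4 := rfl
/-- Reading `dd`. [folklore] -/
@[simp] theorem mk_dd : mk zi z1 z2 z3 z4 zd zf zv zp za za2 zt zg zo .dd = zd := rfl
/-- Reading `fl`. [folklore] -/
@[simp] theorem mk_fl : mk zi z1 z2 z3 z4 zd zf zv zp za za2 zt zg zo .fl = zf := rfl
/-- Reading `vv`. [folklore] -/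
@[simp] theorem mk_vv : mk zi z1 z2 z3 z4 zd zf zv zp za za2 zt zg zo .vv = zv := rfl
/-- Reading `pw`. [folklore] -/
@[simp] theorem mk_pw : mk zi z1 z2 z3 z4 zd zf zv zp za za2 zt zg zo .pw = zp := rfl
/-- Reading `acc`. [folklore] -/
@[simp] theorem mk_acc : mk zi z1 z2 z3 z4 zd zf zv zp za za2 zt zg zo .acc = za := rfl
/-- Reading `acc2`. [folklore] -/
@[simp] theorem mk_acc2 : mk zi z1 z2 z3 z4 zd zf zv zp za za2 zt zg zo .acc2 = za2 := rfl
/-- Reading `tmp`. [folklore] -/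
@[simp] theorem mk_tmp : mk zi z1 z2 z3 z4 zd zf zv zp za za2 zt zg zo .tmp = zt := rfl
/-- Reading `pg`. [folklore] -/
@[simp] theorem mk_pg : mk zi z1 z2 z3 z4 zd zf zv zp za za2 zt zg zo .pg = zg := rfl
/-- Reading `out`. [folklore] -/
@[simp] theorem mk_out : mk zi z1 z2 z3 z4 zd zf zv zp za za2 zt zg zo .out = zo := rfl

/-- Updating `inp`. [folklore] -/
@[simp] theorem update_inp : Function.update (mk zi z1 z2 z3 z4 zd zf zv zp za za2 zt zg zo) .inp x =
    mk x z1 z2 z3 z4 zd zf zv zp za za2 zt zg zo := by funext r; cases r <;> simp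
/-- Updating `l1`. [folklore] -/
@[simp] theorem update_l1 : Function.update (mk zi z1 z2 z3 z4 zd zf zv zp za za2 zt zg zo) .l1 x =
    mk zi x z2 z3 z4 zd zf zv zp za za2 zt zg zo := by funext r; cases r <;> simp
/-- Updating `l2`. [folklore] -/
@[simp] theorem update_l2 : Function.update (mk zi z1 z2 z3 z4 zd zf zv zp za za2 zt zg zo) .l2 x =
    mk zi z1 x z3 z4 zd zf zv zp za za2 zt zg zo := by funext r; cases r <;> simp
/-- Updating `l3`. [folklore] -/
@[simp] theorem update_l3 : Function.update (mk zi z1 z2 z3 z4 zd zf zv zp za za2 zt zg zo) .l3 x =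
    mk zi z1 z2 x z4 zd zf zv zp za za2 zt zg zo := by funext r; cases r <;> simp
/-- Updating `l4`. [folklore] -/
@[simp] theorem update_l4 : Function.update (mk zi z1 z2 z3 z4 zd zf zv zp za za2 zt zg zo) .l4 x =
    mk zi z1 z2 z3 x zd zf zv zp za za2 zt zg zo := by funext r; cases r <;> simp
/-- Updating `dd`. [folklore] -/
@[simp] theorem update_dd : Function.update (mk zi z1 z2 z3 z4 zd zf zv zp za za2 zt zg zo) .dd x =
    mk zi z1 z2 z3 z4 x zf zv zp za za2 zt zg zo := by funext r; cases r <;> simp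
/-- Updating `fl`. [folklore] -/
@[simp] theorem update_fl : Function.update (mk zi z1 z2 z3 z4 zd zf zv zp za za2 zt zg zo) .fl x =
    mk zi z1 z2 z3 z4 zd x zv zp za za2 zt zg zo := by funext r; cases r <;> simp
/-- Updating `vv`. [folklore] -/
@[simp] theorem update_vv : Function.update (mk zi z1 z2 z3 z4 zd zf zv zp za za2 zt zg zo) .vv x =
    mk zi z1 z2 z3 z4 zd zf x zp za za2 zt zg zo := by funext r; cases r <;> simp
/-- Updating `pw`. [folklore] -/
@[simp] theorem update_pw : Function.update (mk zi z1 z2 z3 z4 zd zf zv zp za za2 zt zg zo) .pw x =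
    mk zi z1 z2 z3 z4 zd zf zv x za za2 zt zg zo := by funext r; cases r <;> simp
/-- Updating `acc`. [folklore] -/
@[simp] theorem update_acc : Function.update (mk zi z1 z2 z3 z4 zd zf zv zp za za2 zt zg zo) .acc x =
    mk zi z1 z2 z3 z4 zd zf zv zp x za2 zt zg zo := by funext r; cases r <;> simp
/-- Updating `acc2`. [folklore] -/
@[simp] theorem update_acc2 : Function.update (mk zi z1 z2 z3 z4 zd zf zv zp za za2 zt zg zo) .acc2 x =
    mk zi z1 z2 z3 z4 zd zf zv zp za x zt zg zo := by funext r; cases r <;> simp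
/-- Updating `tmp`. [folklore] -/
@[simp] theorem update_tmp : Function.update (mk zi z1 z2 z3 z4 zd zf zv zp za za2 zt zg zo) .tmp x =
    mk zi z1 z2 z3 z4 zd zf zv zp za za2 x zg zo := by funext r; cases r <;> simp
/-- Updating `pg`. [folklore] -/
@[simp] theorem update_pg : Function.update (mk zi z1 z2 z3 z4 zd zf zv zp za za2 zt zg zo) .pg x =
    mk zi z1 z2 z3 z4 zd zf zv zp za za2 zt x zo := by funext r; cases r <;> simp
/-- Updating `out`. [folklore] -/
@[simp] theorem update_out : Function.update (mk zi z1 z2 z3 z4 zd zf zv zp za za2 zt zg zo) .out x =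
    mk zi z1 z2 z3 z4 zd zf zv zp za za2 zt zg x := by funext r; cases r <;> simp

end MkLemmas

/-- The initial register file. [folklore] -/
theorem init_eq (z : List Bool) : Complexity.Regs.init Rg.inp z = mk z [] [] [] [] [] [] [] [] [] [] [] [] [] := by
  funext r; cases r <;> simp [Complexity.Regs.init, mk]

/-! #### Scanning the input: four unary copies of `L`, input restored -/

/-- Body of the scan: keep the bit (reversed) and count it four times. [folklore] -/
def scanBody (b : Bool) : Complexity.Com Rg := push .tmp b ;; push .l1 true ;; push .l2 true ;; push .l3 true ;; push .l4 true

/-- The scan loop. [folklore] -/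
def scanLoop : Complexity.Com Rg := loop .inp (scanBody true) (scanBody false)

/-- Scan and restore the input. [folklore] -/
def scan : Complexity.Com Rg := scanLoop ;; pour .tmp .inp

/-- Semantics of `scanBody` (cost `5`). [folklore] -/
theorem runs_scanBody (b : Bool) (w : List Bool) (L : ℕ) (zd zf zv zp za za2 zt zg zo : List Bool) :
    Runs (scanBody b) (mk w (Complexity.ones L) (Complexity.ones L) (Complexity.ones L) (Complexity.ones L) zd zf zv zp za za2 zt zg zo)
      (mk w (Complexity.ones (L + 1)) (Complexity.ones (L + 1)) (Complexity.ones (L + 1)) (Complexity.ones (L + 1)) zd zf zv zp za za2 (b :: zt) zg zo)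
      (1 + (1 + (1 + (1 + 1)))) := by
  simpa [scanBody, ones_succ] using (Runs.push Rg.tmp b (mk w (Complexity.ones L) (Complexity.ones L) (Complexity.ones L) (Complexity.ones L) zd zf zv zp za za2 zt zg zo)).seq
    ((Runs.push Rg.l1 true _).seq ((Runs.push Rg.l2 true _).seq ((Runs.push Rg.l3 true _).seq (Runs.push Rg.l4 true _))))

/-- **Semantics of the scan loop** (cost `7|w| + 1`). [folklore] -/
theorem runs_scanLoop : ∀ (w : List Bool) (L : ℕ) (zd zf zv zp za za2 zt zg zo : List Bool),
    Runs scanLoop (mk w (Complexity.ones L) (Complexity.ones L) (Complexity.ones L) (Complexity.ones L) zd zf zv zp za za2 zt zg zo)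
      (mk [] (Complexity.ones (w.length + L)) (Complexity.ones (w.length + L)) (Complexity.ones (w.length + L)) (Complexity.ones (w.length + L)) zd zf zv zp za za2
        (w.reverse ++ zt) zg zo) (7 * w.length + 1)
  | [], L, zd, zf, zv, zp, za, za2, zt, zg, zo => by
    have h : Runs scanLoop (mk [] (Complexity.ones L) (Complexity.ones L) (Complexity.ones L) (Complexity.ones L) zd zf zv zp za za2 zt zg zo)
        (mk [] (Complexity.ones L) (Complexity.ones L) (Complexity.ones L) (Complexity.ones L) zd zf zv zp za za2 zt zg zo) 1 := Runs.loop_nil (k := Rg.inp) _ _ rfl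
    simpa using h
  | b :: w, L, zd, zf, zv, zp, za, za2, zt, zg, zo => by
    have hbody := runs_scanBody b w L zd zf zv zp za za2 zt zg zo
    have ih := runs_scanLoop w (L + 1) zd zf zv zp za za2 (b :: zt) zg zo
    rw [show w.length + (L + 1) = (b :: w).length + L by simp; omega,
      show w.reverse ++ b :: zt = (b :: w).reverse ++ zt by simp] at ih
    rw [show 7 * (b :: w).length + 1 = (1 + (1 + (1 + (1 + 1)))) + 2 + (7 * w.length + 1) by simp; ring]
    cases b
    · exact Runs.loop_false' (R := mk (false :: w) (Complexity.ones L) (Complexity.ones L) (Complexity.ones L) (Complexity.ones L) zd zf zv zp za za2 zt zg zo) rfl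
        (update_inp ..) hbody ih
    · exact Runs.loop_true' (R := mk (true :: w) (Complexity.ones L) (Complexity.ones L) (Complexity.ones L) (Complexity.ones L) zd zf zv zp za za2 zt zg zo) rfl
        (update_inp ..) hbody ih

/-- **Semantics of `scan`** (cost `10|x| + 2`): four copies of `|x|`, input restored. [folklore] -/
theorem runs_scan (x : List Bool) :
    Runs scan (mk x [] [] [] [] [] [] [] [] [] [] [] [] [])
      (mk x (Complexity.ones x.length) (Complexity.ones x.length) (Complexity.ones x.length) (Complexity.ones x.length) [] [] [] [] [] [] [] [] []) (10 * x.length + 2) := by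
  have h1 := runs_scanLoop x 0 [] [] [] [] [] [] [] [] []
  simp only [Nat.add_zero, List.append_nil] at h1
  have h2 : Runs (pour .tmp .inp)
      (mk [] (Complexity.ones x.length) (Complexity.ones x.length) (Complexity.ones x.length) (Complexity.ones x.length) [] [] [] [] [] [] x.reverse [] [])
      (mk x (Complexity.ones x.length) (Complexity.ones x.length) (Complexity.ones x.length) (Complexity.ones x.length) [] [] [] [] [] [] [] [] []) (3 * x.length + 1) := by
    have := runs_pour (a := Rg.tmp) (b := Rg.inp) (by decide)
      (mk [] (Complexity.ones x.length) (Complexity.ones x.length) (Complexity.ones x.length) (Complexity.ones x.length) [] [] [] [] [] [] x.reverse [] [])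
    simpa using this
  exact (h1.seq h2).mono (by omega)

/-! #### The field width `D = Nat.size L` -/

/-- After `⌊log₂ L⌋` (in `dd`), add one unit iff the input is nonempty (`L ≥ 1`), peeking at the
first input bit. [folklore] -/
def sizeFix : Complexity.Com Rg := pop .inp (push .inp true ;; push .dd true) (push .inp false ;; push .dd true) skip

/-- `Nat.size L = ⌊log₂ L⌋ + 1` for `L ≥ 1`. [folklore] -/
theorem size_eq_log_succ {L : ℕ} (hL : L ≠ 0) : Nat.size L = Nat.log 2 L + 1 := by
  apply le_antisymm
  · exact Nat.size_le.2 (Nat.lt_pow_succ_log_self one_lt_two L)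
  · exact Nat.lt_size.2 (Nat.pow_log_le_self 2 hL)

/-- Semantics of `sizeFix` (cost `≤ 4`): `dd` gains `[x ≠ []]` units. [folklore] -/
theorem runs_sizeFix (x : List Bool) (z1 z2 z3 z4 : List Bool) (D : ℕ) (zf zv zp za za2 zt zg zo : List Bool) :
    Runs sizeFix (mk x z1 z2 z3 z4 (Complexity.ones D) zf zv zp za za2 zt zg zo)
      (mk x z1 z2 z3 z4 (Complexity.ones (D + if x = [] then 0 else 1)) zf zv zp za za2 zt zg zo) 4 := by
  unfold sizeFix
  rcases x with _ | ⟨b, x⟩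
  · simpa using (Runs.pop_nil _ _ (rfl : mk [] z1 z2 z3 z4 (Complexity.ones D) zf zv zp za za2 zt zg zo .inp = []) (Runs.skip _)).mono
      (show 0 + 2 ≤ 4 by norm_num)
  · have h2 : ∀ c : Bool, Runs (push .inp c ;; push .dd true) (mk x z1 z2 z3 z4 (Complexity.ones D) zf zv zp za za2 zt zg zo)
        (mk (c :: x) z1 z2 z3 z4 (Complexity.ones (D + 1)) zf zv zp za za2 zt zg zo) (1 + 1) := fun c => by
      simpa [ones_succ] using (Runs.push Rg.inp c (mk x z1 z2 z3 z4 (Complexity.ones D) zf zv zp za za2 zt zg zo)).seq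
        (Runs.push Rg.dd true _)
    cases b
    · simpa using Runs.pop_false' (R := mk (false :: x) z1 z2 z3 z4 (Complexity.ones D) zf zv zp za za2 zt zg zo) _ _ rfl
        (update_inp ..) (h2 false)
    · simpa using Runs.pop_true' (R := mk (true :: x) z1 z2 z3 z4 (Complexity.ones D) zf zv zp za za2 zt zg zo) _ _ rfl
        (update_inp ..) (h2 true)

/-! #### Reading the length field: bits, value, power of two -/

/-- Body of the field loop: count down `l3`, read one field bit (kept on `fl`), add its weight `pw`
to the value `vv` if set, double the weight. [folklore] -/
def fldBody : Complexity.Com Rg :=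
  pop .l3 skip skip skip ;;
  pop .inp (push .fl true ;; addReg .pw .vv .tmp ;; dblReg .pw .tmp) (push .fl false ;; dblReg .pw .tmp) skip

/-- The field loop, driven by the counter `dd = 1ᴰ`. [folklore] -/
def fldLoop : Complexity.Com Rg := loop .dd fldBody fldBody

/-- Cost of the field loop from weight `P` over `D` bits. [folklore] -/
def fldCost : ℕ → ℕ → ℕ
  | 0, _ => 1
  | D + 1, P => 17 * P + 13 + fldCost D (2 * P)

/-- The cost recursion, in the shape used by the loop lemma. [folklore] -/
theorem fldCost_succ (D P : ℕ) : fldCost (D + 1) P = (17 * P + 11) + 2 + fldCost D (2 * P) := by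
  show 17 * P + 13 + fldCost D (2 * P) = _; omega

/-- **Semantics of the field body** on a nonempty input (cost `≤ 17P + 11`). [folklore] -/
theorem runs_fldBody (b : Bool) (w z1 z2 : List Bool) (L3 : ℕ) (z4 zd zf : List Bool) (V P : ℕ)
    (za za2 zg zo : List Bool) :
    Runs fldBody (mk (b :: w) z1 z2 (Complexity.ones L3) z4 zd zf (Complexity.ones V) (Complexity.ones P) za za2 [] zg zo)
      (mk w z1 z2 (Complexity.ones (L3 - 1)) z4 zd (b :: zf) (Complexity.ones (V + b.toNat * P)) (Complexity.ones (2 * P)) za za2 [] zg zo) (17 * P + 11) := by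
  have h1 : Runs (pop .l3 skip skip skip) (mk (b :: w) z1 z2 (Complexity.ones L3) z4 zd zf (Complexity.ones V) (Complexity.ones P) za za2 [] zg zo)
      (mk (b :: w) z1 z2 (Complexity.ones (L3 - 1)) z4 zd zf (Complexity.ones V) (Complexity.ones P) za za2 [] zg zo) 2 := by
    have := runs_pop1 Rg.l3 (mk (b :: w) z1 z2 (Complexity.ones L3) z4 zd zf (Complexity.ones V) (Complexity.ones P) za za2 [] zg zo)
    simpa [drop_ones] using this
  refine (h1.seq ?_).mono (show 2 + ((17 * P + 6) + 2) ≤ 17 * P + 11 by omega)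
  have hdbl : ∀ (zf' : List Bool) (V' : ℕ), Runs (dblReg .pw .tmp)
      (mk w z1 z2 (Complexity.ones (L3 - 1)) z4 zd zf' (Complexity.ones V') (Complexity.ones P) za za2 [] zg zo)
      (mk w z1 z2 (Complexity.ones (L3 - 1)) z4 zd zf' (Complexity.ones V') (Complexity.ones (2 * P)) za za2 [] zg zo) (10 * P + 2) := fun zf' V' => by
    have := runs_dblReg (p := Rg.pw) (t := Rg.tmp) (by decide)
      (mk w z1 z2 (Complexity.ones (L3 - 1)) z4 zd zf' (Complexity.ones V') (Complexity.ones P) za za2 [] zg zo) rfl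
    simpa using this
  cases b
  · have h2 : Runs (push .fl false) (mk w z1 z2 (Complexity.ones (L3 - 1)) z4 zd zf (Complexity.ones V) (Complexity.ones P) za za2 [] zg zo)
        (mk w z1 z2 (Complexity.ones (L3 - 1)) z4 zd (false :: zf) (Complexity.ones V) (Complexity.ones P) za za2 [] zg zo) 1 := Runs.push' (update_fl ..)
    simpa using Runs.pop_false' (R := mk (false :: w) z1 z2 (Complexity.ones (L3 - 1)) z4 zd zf (Complexity.ones V) (Complexity.ones P) za za2 [] zg zo)
      _ _ rfl (update_inp ..) ((h2.seq (hdbl (false :: zf) V)).mono (show 1 + (10 * P + 2) ≤ 17 * P + 6 by omega))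
  · have h2 : Runs (push .fl true) (mk w z1 z2 (Complexity.ones (L3 - 1)) z4 zd zf (Complexity.ones V) (Complexity.ones P) za za2 [] zg zo)
        (mk w z1 z2 (Complexity.ones (L3 - 1)) z4 zd (true :: zf) (Complexity.ones V) (Complexity.ones P) za za2 [] zg zo) 1 := Runs.push' (update_fl ..)
    have h3 : Runs (addReg .pw .vv .tmp) (mk w z1 z2 (Complexity.ones (L3 - 1)) z4 zd (true :: zf) (Complexity.ones V) (Complexity.ones P) za za2 [] zg zo)
        (mk w z1 z2 (Complexity.ones (L3 - 1)) z4 zd (true :: zf) (Complexity.ones (V + P)) (Complexity.ones P) za za2 [] zg zo) (7 * P + 2) := by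
      have := runs_addReg (p := Rg.pw) (v := Rg.vv) (t := Rg.tmp) (by decide) (by decide) (by decide)
        (mk w z1 z2 (Complexity.ones (L3 - 1)) z4 zd (true :: zf) (Complexity.ones V) (Complexity.ones P) za za2 [] zg zo) rfl
      simpa [ones_append, Nat.add_comm P V] using this
    simpa using Runs.pop_true' (R := mk (true :: w) z1 z2 (Complexity.ones (L3 - 1)) z4 zd zf (Complexity.ones V) (Complexity.ones P) za za2 [] zg zo)
      _ _ rfl (update_inp ..) ((h2.seq (h3.seq (hdbl (true :: zf) (V + P)))).mono (by omega))

/-- **Semantics of the field loop** while input remains (`D ≤ |w|`): the `D` bits read go onto `fl`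
(reversed), the value gains `P · bitsToNat (w ↾ D)`, the weight becomes `2ᴰ P`, `l3` loses `D`.
[folklore] -/
theorem runs_fldLoop : ∀ (D : ℕ) (w : List Bool), D ≤ w.length → ∀ (z1 z2 : List Bool) (L3 : ℕ) (z4 zf : List Bool)
    (V P : ℕ) (za za2 zg zo : List Bool),
    Runs fldLoop (mk w z1 z2 (Complexity.ones L3) z4 (Complexity.ones D) zf (Complexity.ones V) (Complexity.ones P) za za2 [] zg zo)
      (mk (w.drop D) z1 z2 (Complexity.ones (L3 - D)) z4 [] ((w.take D).reverse ++ zf) (Complexity.ones (V + P * Complexity.bitsToNat (w.take D)))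
        (Complexity.ones (2 ^ D * P)) za za2 [] zg zo) (fldCost D P)
  | 0, w, _, z1, z2, L3, z4, zf, V, P, za, za2, zg, zo => by
    have h : Runs fldLoop (mk w z1 z2 (Complexity.ones L3) z4 [] zf (Complexity.ones V) (Complexity.ones P) za za2 [] zg zo)
        (mk w z1 z2 (Complexity.ones L3) z4 [] zf (Complexity.ones V) (Complexity.ones P) za za2 [] zg zo) 1 := Runs.loop_nil (k := Rg.dd) _ _ rfl
    simpa [fldCost] using h
  | D + 1, [], hD, z1, z2, L3, z4, zf, V, P, za, za2, zg, zo => by simp at hD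
  | D + 1, b :: w, hD, z1, z2, L3, z4, zf, V, P, za, za2, zg, zo => by
    have hbody := runs_fldBody b w z1 z2 L3 z4 (Complexity.ones D) zf V P za za2 zg zo
    have ih := runs_fldLoop D w (by simpa using hD) z1 z2 (L3 - 1) z4 (b :: zf) (V + b.toNat * P) (2 * P) za za2 zg zo
    rw [show L3 - 1 - D = L3 - (D + 1) by omega,
      show (w.take D).reverse ++ b :: zf = ((b :: w).take (D + 1)).reverse ++ zf by simp,
      show V + b.toNat * P + 2 * P * Complexity.bitsToNat (w.take D) = V + P * Complexity.bitsToNat ((b :: w).take (D + 1)) by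
        simp [Complexity.bitsToNat_cons]; ring,
      show 2 ^ D * (2 * P) = 2 ^ (D + 1) * P by ring] at ih
    rw [fldCost_succ]
    exact Runs.loop_true' (R := mk (b :: w) z1 z2 (Complexity.ones L3) z4 (Complexity.ones (D + 1)) zf (Complexity.ones V) (Complexity.ones P) za za2 [] zg zo) rfl
      (update_dd ..) hbody ih

/-- Closed bound for the cost of the field loop. [folklore] -/
theorem fldCost_le : ∀ (D P : ℕ), fldCost D P + 17 * P ≤ 17 * P * 2 ^ D + 13 * D + 1
  | 0, P => by simp only [fldCost, pow_zero, mul_one, mul_zero, add_zero]; omega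
  | D + 1, P => by
    have ih := fldCost_le D (2 * P)
    simp only [fldCost]
    have : 17 * (2 * P) * 2 ^ D = 17 * P * 2 ^ (D + 1) := by ring
    omega

/-! #### Output assembly -/

/-- The separator `01` of `boolPair` (pushed in reverse). [folklore] -/
def sep : Complexity.Com Rg := push .out true ;; push .out false

/-- Four output units per unit of `l4` (the doubly doubled `1ᴸ`). [folklore] -/
def quadL : Complexity.Com Rg := loop .l4 (pushK .out 4) (pushK .out 4)

/-- Assemble `⟨⟨1ᴸ, ℓ⟩, ⟨Π, 1ˢ⟩⟩` bottom-up: `1ˢ`, separator, `Π` doubled, separator, `ℓ`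
doubled, the doubled separator `0011`, `1^{4L}`. [folklore] -/
def output : Complexity.Com Rg :=
  pour .acc .out ;; sep ;; pourDbl .pg .out ;; sep ;; pourDbl .fl .out ;;
  push .out true ;; push .out true ;; push .out false ;; push .out false ;; quadL

/-- Semantics of `sep` (cost `2`). [folklore] -/
theorem runs_sep (zi z1 z2 z3 z4 zd zf zv zp za za2 zt zg zo : List Bool) :
    Runs sep (mk zi z1 z2 z3 z4 zd zf zv zp za za2 zt zg zo) (mk zi z1 z2 z3 z4 zd zf zv zp za za2 zt zg (false :: true :: zo))
      (1 + 1) := by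
  simpa [sep] using (Runs.push Rg.out true (mk zi z1 z2 z3 z4 zd zf zv zp za za2 zt zg zo)).seq (Runs.push Rg.out false _)

/-- Semantics of `quadL` (cost `6L + 1`). [folklore] -/
theorem runs_quadL : ∀ (L : ℕ) (zi z1 z2 z3 zd zf zv zp za za2 zt zg zo : List Bool),
    Runs quadL (mk zi z1 z2 z3 (Complexity.ones L) zd zf zv zp za za2 zt zg zo) (mk zi z1 z2 z3 [] zd zf zv zp za za2 zt zg (Complexity.ones (4 * L) ++ zo))
      (6 * L + 1)
  | 0, zi, z1, z2, z3, zd, zf, zv, zp, za, za2, zt, zg, zo => by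
    have h : Runs quadL (mk zi z1 z2 z3 [] zd zf zv zp za za2 zt zg zo) (mk zi z1 z2 z3 [] zd zf zv zp za za2 zt zg zo) 1 :=
      Runs.loop_nil (k := Rg.l4) _ _ rfl
    simpa using h
  | L + 1, zi, z1, z2, z3, zd, zf, zv, zp, za, za2, zt, zg, zo => by
    have hbody : Runs (pushK .out 4) (mk zi z1 z2 z3 (Complexity.ones L) zd zf zv zp za za2 zt zg zo)
        (mk zi z1 z2 z3 (Complexity.ones L) zd zf zv zp za za2 zt zg (Complexity.ones 4 ++ zo)) 4 := by
      have := runs_pushK Rg.out 4 (mk zi z1 z2 z3 (Complexity.ones L) zd zf zv zp za za2 zt zg zo)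
      simpa using this
    have ih := runs_quadL L zi z1 z2 z3 zd zf zv zp za za2 zt zg (Complexity.ones 4 ++ zo)
    rw [← List.append_assoc, ones_append, show 4 * L + 4 = 4 * (L + 1) by ring] at ih
    rw [show 6 * (L + 1) + 1 = 4 + 2 + (6 * L + 1) by ring]
    exact Runs.loop_true' (R := mk zi z1 z2 z3 (Complexity.ones (L + 1)) zd zf zv zp za za2 zt zg zo) rfl (update_l4 ..) hbody ih

/-- **Semantics of the output assembly.** [folklore] -/
theorem runs_output (zi z1 z2 z3 : List Bool) (L : ℕ) (zd F : List Bool) (zv zp : List Bool) (s : ℕ)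
    (za2 zt G : List Bool) :
    Runs output (mk zi z1 z2 z3 (Complexity.ones L) zd F zv zp (Complexity.ones s) za2 zt G [])
      (mk zi z1 z2 z3 [] zd [] zv zp [] za2 zt []
        (Complexity.ones (4 * L) ++ false :: false :: true :: true :: (dbl F.reverse ++ false :: true :: (dbl G.reverse ++ false :: true :: Complexity.ones s))))
      ((3 * s + 1) + ((1 + 1) + ((4 * G.length + 1) + ((1 + 1) + ((4 * F.length + 1) + (1 + (1 + (1 + (1 + (6 * L + 1)))))))))) := by
  have h1 : Runs (pour .acc .out) (mk zi z1 z2 z3 (Complexity.ones L) zd F zv zp (Complexity.ones s) za2 zt G [])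
      (mk zi z1 z2 z3 (Complexity.ones L) zd F zv zp [] za2 zt G (Complexity.ones s)) (3 * s + 1) := by
    have := runs_pour (a := Rg.acc) (b := Rg.out) (by decide) (mk zi z1 z2 z3 (Complexity.ones L) zd F zv zp (Complexity.ones s) za2 zt G [])
    simpa using this
  have h2 := runs_sep zi z1 z2 z3 (Complexity.ones L) zd F zv zp [] za2 zt G (Complexity.ones s)
  have h3 : Runs (pourDbl .pg .out) (mk zi z1 z2 z3 (Complexity.ones L) zd F zv zp [] za2 zt G (false :: true :: Complexity.ones s))
      (mk zi z1 z2 z3 (Complexity.ones L) zd F zv zp [] za2 zt [] (dbl G.reverse ++ false :: true :: Complexity.ones s)) (4 * G.length + 1) := by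
    have := runs_pourDbl (k := Rg.pg) (o := Rg.out) (by decide) G
      (mk zi z1 z2 z3 (Complexity.ones L) zd F zv zp [] za2 zt G (false :: true :: Complexity.ones s)) rfl
    simpa using this
  have h4 := runs_sep zi z1 z2 z3 (Complexity.ones L) zd F zv zp [] za2 zt [] (dbl G.reverse ++ false :: true :: Complexity.ones s)
  have h5 : Runs (pourDbl .fl .out)
      (mk zi z1 z2 z3 (Complexity.ones L) zd F zv zp [] za2 zt [] (false :: true :: (dbl G.reverse ++ false :: true :: Complexity.ones s)))
      (mk zi z1 z2 z3 (Complexity.ones L) zd [] zv zp [] za2 zt []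
        (dbl F.reverse ++ false :: true :: (dbl G.reverse ++ false :: true :: Complexity.ones s))) (4 * F.length + 1) := by
    have := runs_pourDbl (k := Rg.fl) (o := Rg.out) (by decide) F
      (mk zi z1 z2 z3 (Complexity.ones L) zd F zv zp [] za2 zt [] (false :: true :: (dbl G.reverse ++ false :: true :: Complexity.ones s))) rfl
    simpa using this
  set W := dbl F.reverse ++ false :: true :: (dbl G.reverse ++ false :: true :: Complexity.ones s)
  have h6 : Runs (push .out true) (mk zi z1 z2 z3 (Complexity.ones L) zd [] zv zp [] za2 zt [] W)
      (mk zi z1 z2 z3 (Complexity.ones L) zd [] zv zp [] za2 zt [] (true :: W)) 1 := Runs.push' (update_out ..)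
  have h7 : Runs (push .out true) (mk zi z1 z2 z3 (Complexity.ones L) zd [] zv zp [] za2 zt [] (true :: W))
      (mk zi z1 z2 z3 (Complexity.ones L) zd [] zv zp [] za2 zt [] (true :: true :: W)) 1 := Runs.push' (update_out ..)
  have h8 : Runs (push .out false) (mk zi z1 z2 z3 (Complexity.ones L) zd [] zv zp [] za2 zt [] (true :: true :: W))
      (mk zi z1 z2 z3 (Complexity.ones L) zd [] zv zp [] za2 zt [] (false :: true :: true :: W)) 1 := Runs.push' (update_out ..)
  have h9 : Runs (push .out false) (mk zi z1 z2 z3 (Complexity.ones L) zd [] zv zp [] za2 zt [] (false :: true :: true :: W))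
      (mk zi z1 z2 z3 (Complexity.ones L) zd [] zv zp [] za2 zt [] (false :: false :: true :: true :: W)) 1 := Runs.push' (update_out ..)
  have h10 := runs_quadL L zi z1 z2 z3 zd [] zv zp [] za2 zt [] (false :: false :: true :: true :: W)
  exact h1.seq (h2.seq (h3.seq (h4.seq (h5.seq (h6.seq (h7.seq (h8.seq (h9.seq h10))))))))

/-! #### The whole program -/

/-- **The preprocessing program** of the one-way function candidate. [folklore] -/
noncomputable def prog (t : Polynomial ℕ) (c : ℕ) : Complexity.Com Rg :=
  scan ;; logCount .l1 .l2 .acc .dd ;; sizeFix ;; push .pw true ;; fldLoop ;; takeN .vv .inp .pg ;; popK .l3 c ;;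
  hornerProg .l3 .acc .acc2 .tmp (coeffsHL t) ;; output

/-- The field width attached to length `L`: `⌊log₂ L⌋ + [L ≥ 1] = Nat.size L`. [folklore] -/
def dOf (L : ℕ) : ℕ := Nat.log 2 L + if L = 0 then 0 else 1

/-- `dOf L = Nat.size L`. [folklore] -/
theorem dOf_eq_size (L : ℕ) : dOf L = Nat.size L := by
  unfold dOf
  by_cases h : L = 0
  · subst h; simp
  · rw [if_neg h, size_eq_log_succ h]

/-- `dOf L ≤ L`. [folklore] -/
theorem dOf_le (L : ℕ) : dOf L ≤ L := by
  rw [dOf_eq_size]; exact Nat.size_le.2 (Nat.lt_two_pow_self)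

/-- `2 ^ dOf L ≤ 2L + 1`. [folklore] -/
theorem two_pow_dOf_le (L : ℕ) : 2 ^ dOf L ≤ 2 * L + 1 := by
  unfold dOf
  by_cases h : L = 0
  · subst h; simp
  · rw [if_neg h, pow_succ]
    have := Nat.pow_log_le_self 2 h
    omega

end LPO

open LPO Complexity.Com Complexity.SProg in
/-- **The function computed by the preprocessing program**: with `L = |x|`, `D = Nat.size L`
(`LPO.dOf`), `ℓ = x ↾ D`, `v = bitsToNat ℓ`, `Π = (x ⇂ D) ↾ v`, `s = t(L - D - c)`, the value is
`⟨⟨1ᴸ, ℓ⟩, ⟨Π, 1ˢ⟩⟩`. [Y. Liu, R. Pass, FOCS 2020, proof of Thm 4.1] [folklore] -/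
def lpoFn (t : Polynomial ℕ) (c : ℕ) (x : List Bool) : List Bool :=
  Complexity.boolPair (Complexity.boolPair (Complexity.ones x.length) (x.take (LPO.dOf x.length)))
    (Complexity.boolPair ((x.drop (LPO.dOf x.length)).take (Complexity.bitsToNat (x.take (LPO.dOf x.length))))
      (Complexity.ones (t.eval (x.length - LPO.dOf x.length - c))))

namespace LPO

open Complexity.Com Complexity.SProg

/-- The cost of the program on an input of length `L` (sum of the phase bounds). [folklore] -/
def progCost (t : Polynomial ℕ) (c L : ℕ) : ℕ :=
  (10 * L + 2) + (L * (7 * L + 13) + 1) + 4 + 1 + fldCost (dOf L) 1 + (5 * (2 ^ dOf L) + 1) + 2 * c +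
  (t.natDegree + 1) * (t.eval (L - dOf L - c + 1) * (10 * (L - dOf L - c) + 5) + 2) +
  ((3 * t.eval (L - dOf L - c) + 1) + ((1 + 1) + ((4 * (2 ^ dOf L) + 1) + ((1 + 1) + ((4 * dOf L + 1) +
    (1 + (1 + (1 + (1 + (6 * L + 1))))))))))

/-- **Semantics of the whole program.** [folklore] -/
theorem runs_prog (t : Polynomial ℕ) (c : ℕ) (x : List Bool) :
    ∃ R', Runs (prog t c) (Complexity.Regs.init Rg.inp x) R' (progCost t c x.length) ∧ R' .out = lpoFn t c x := by
  rw [init_eq]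
  set L := x.length with hL
  set D := dOf L with hD
  have hDL : D ≤ L := dOf_le L
  have hDx : D ≤ x.length := by rwa [← hL]
  set fld := x.take D with hfld
  set v := Complexity.bitsToNat fld with hv
  set prg := (x.drop D).take v with hprg
  set n' := L - D - c with hn'
  set s := t.eval n' with hs
  clear_value s n' prg v fld D L
  -- 1. scan
  have h1 := runs_scan x
  rw [← hL] at h1
  -- 2. logarithm
  have h2 : Runs (logCount .l1 .l2 .acc .dd) (mk x (Complexity.ones L) (Complexity.ones L) (Complexity.ones L) (Complexity.ones L) [] [] [] [] [] [] [] [] [])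
      (mk x [] [] (Complexity.ones L) (Complexity.ones L) (Complexity.ones (Nat.log 2 L)) [] [] [] [] [] [] [] []) (L * (7 * L + 13) + 1) := by
    have := runs_logCount (f := Rg.l1) (v := Rg.l2) (a := Rg.acc) (d := Rg.dd) (by decide) (by decide) (by decide)
      (by decide) (by decide) (by decide) L L 0 (mk x (Complexity.ones L) (Complexity.ones L) (Complexity.ones L) (Complexity.ones L) [] [] [] [] [] [] [] [] []) rfl rfl rfl rfl
    rw [logC_snd L L 0 le_rfl, logC_fst L L 0 le_rfl, Nat.zero_add] at this
    simpa using this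
  -- 3. size
  have h3 := runs_sizeFix x [] [] (Complexity.ones L) (Complexity.ones L) (Nat.log 2 L) [] [] [] [] [] [] [] []
  have hDeq : Nat.log 2 L + (if x = [] then 0 else 1) = D := by
    rw [hD, dOf, hL]
    congr 1
    by_cases hx : x = [] <;> simp [hx]
  rw [hDeq] at h3
  -- 4. weight `1`
  have h4 : Runs (push .pw true) (mk x [] [] (Complexity.ones L) (Complexity.ones L) (Complexity.ones D) [] [] [] [] [] [] [] [])
      (mk x [] [] (Complexity.ones L) (Complexity.ones L) (Complexity.ones D) [] (Complexity.ones 0) (Complexity.ones 1) [] [] [] [] []) 1 := Runs.push' (update_pw ..)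
  -- 5. field
  have h5 := runs_fldLoop D x hDx [] [] L (Complexity.ones L) [] 0 1 [] [] [] []
  rw [← hfld, ← hv, List.append_nil, Nat.zero_add, Nat.one_mul, Nat.mul_one] at h5
  -- 6. program
  have h6 : Runs (takeN .vv .inp .pg) (mk (x.drop D) [] [] (Complexity.ones (L - D)) (Complexity.ones L) [] fld.reverse (Complexity.ones v) (Complexity.ones (2 ^ D)) [] [] [] [] [])
      (mk ((x.drop D).drop v) [] [] (Complexity.ones (L - D)) (Complexity.ones L) [] fld.reverse [] (Complexity.ones (2 ^ D)) [] [] [] prg.reverse []) (5 * v + 1) := by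
    have := runs_takeN (q := Rg.vv) (s := Rg.inp) (d := Rg.pg) (by decide) (by decide) (by decide) (Complexity.ones v)
      (mk (x.drop D) [] [] (Complexity.ones (L - D)) (Complexity.ones L) [] fld.reverse (Complexity.ones v) (Complexity.ones (2 ^ D)) [] [] [] [] []) rfl
    simpa [← hprg] using this
  -- 7. `n' = L - D - c`
  have h7 : Runs (popK .l3 c) (mk ((x.drop D).drop v) [] [] (Complexity.ones (L - D)) (Complexity.ones L) [] fld.reverse [] (Complexity.ones (2 ^ D)) [] [] [] prg.reverse [])
      (mk ((x.drop D).drop v) [] [] (Complexity.ones n') (Complexity.ones L) [] fld.reverse [] (Complexity.ones (2 ^ D)) [] [] [] prg.reverse []) (2 * c) := by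
    have := runs_popK Rg.l3 c (mk ((x.drop D).drop v) [] [] (Complexity.ones (L - D)) (Complexity.ones L) [] fld.reverse [] (Complexity.ones (2 ^ D)) [] [] [] prg.reverse [])
    simpa [drop_ones, ← hn'] using this
  -- 8. `s = t(n')`
  have h8 : Runs (hornerProg .l3 .acc .acc2 .tmp (coeffsHL t))
      (mk ((x.drop D).drop v) [] [] (Complexity.ones n') (Complexity.ones L) [] fld.reverse [] (Complexity.ones (2 ^ D)) [] [] [] prg.reverse [])
      (mk ((x.drop D).drop v) [] [] (Complexity.ones n') (Complexity.ones L) [] fld.reverse [] (Complexity.ones (2 ^ D)) (Complexity.ones s) [] [] prg.reverse [])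
      ((t.natDegree + 1) * (t.eval (n' + 1) * (10 * n' + 5) + 2)) := by
    have := runs_evalPoly (n := Rg.l3) (a := Rg.acc) (a2 := Rg.acc2) (t := Rg.tmp) (by decide) (by decide) (by decide)
      (by decide) (by decide) (by decide) t n'
      (mk ((x.drop D).drop v) [] [] (Complexity.ones n') (Complexity.ones L) [] fld.reverse [] (Complexity.ones (2 ^ D)) [] [] [] prg.reverse []) rfl rfl rfl rfl
    simpa [← hs] using this
  -- 9. output
  have h9 := runs_output ((x.drop D).drop v) [] [] (Complexity.ones n') L [] fld.reverse [] (Complexity.ones (2 ^ D)) s [] [] prg.reverse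
  rw [List.reverse_reverse, List.reverse_reverse, List.length_reverse, List.length_reverse] at h9
  refine ⟨_, (h1.seq (h2.seq (h3.seq (h4.seq (h5.seq (h6.seq (h7.seq (h8.seq h9)))))))).mono ?_, ?_⟩
  · have hv2 : v ≤ 2 ^ D := by
      have := Complexity.bitsToNat_lt fld
      have hlen : fld.length ≤ D := by rw [hfld, List.length_take]; exact min_le_left _ _
      have := Nat.pow_le_pow_right (show 0 < 2 by norm_num) hlen
      omega
    have hfl : fld.length ≤ D := by rw [hfld, List.length_take]; exact min_le_left _ _
    have hpl : prg.length ≤ 2 ^ D := by rw [hprg, List.length_take]; exact (min_le_left _ _).trans hv2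
    simp only [progCost, ← hD, ← hn', ← hs]
    have e1 : 5 * v + 1 ≤ 5 * 2 ^ D + 1 := by omega
    have e2 : 4 * prg.length + 1 ≤ 4 * 2 ^ D + 1 := by omega
    have e3 : 4 * fld.length + 1 ≤ 4 * D + 1 := by omega
    -- (`omega` diverges on this goal; `linarith` closes the linear rearrangement)
    linarith
  · simp only [mk_out, lpoFn, ← hL, ← hD, ← hfld, ← hv, ← hprg, ← hn', ← hs, LPD.boolPair_eq, LPD.dbl_append, dbl_ones,
      dbl_cons, List.append_assoc, List.cons_append, show 2 * (2 * L) = 4 * L by ring]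

/-- **The cost is polynomial**: `progCost t c L ≤ 64 (L + t(L+1) + deg t + c + 2)³`. [folklore] -/
theorem progCost_le (t : Polynomial ℕ) (c L : ℕ) :
    progCost t c L ≤ 64 * (L + t.eval (L + 1) + (t.natDegree + c + 2)) ^ 3 := by
  have hD : dOf L ≤ L := dOf_le L
  have h2D : 2 ^ dOf L ≤ 2 * L + 1 := two_pow_dOf_le L
  have hf : fldCost (dOf L) 1 + 17 * 1 ≤ 17 * 1 * 2 ^ dOf L + 13 * dOf L + 1 := fldCost_le (dOf L) 1
  have ht1 : t.eval (L - dOf L - c + 1) ≤ t.eval (L + 1) := Complexity.TM2Iter.eval_mono t (by omega)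
  have ht0 : t.eval (L - dOf L - c) ≤ t.eval (L + 1) := Complexity.TM2Iter.eval_mono t (by omega)
  unfold progCost
  generalize fldCost (dOf L) 1 = FC at hf ⊢
  generalize t.eval (L - dOf L - c + 1) = a1 at ht1 ⊢
  generalize t.eval (L - dOf L - c) = a0 at ht0 ⊢
  generalize t.eval (L + 1) = A at *
  generalize t.natDegree = dt
  generalize dOf L = D at *
  generalize 2 ^ D = P at *
  generalize hM : L + A + (dt + c + 2) = M
  have hM2 : 2 ≤ M := by omega
  have p1 : (dt + 1) * (a1 * (10 * (L - D - c) + 5) + 2) ≤ 14 * M ^ 3 := by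
    have e : a1 * (10 * (L - D - c) + 5) ≤ M * (13 * M) := Nat.mul_le_mul (by omega) (by omega)
    have e' : M * (13 * M) + 2 ≤ 14 * M ^ 2 := by nlinarith
    calc (dt + 1) * (a1 * (10 * (L - D - c) + 5) + 2) ≤ M * (14 * M ^ 2) := Nat.mul_le_mul (by omega) (by omega)
      _ = 14 * M ^ 3 := by ring
  have p2 : L * (7 * L + 13) ≤ 14 * M ^ 2 :=
    calc L * (7 * L + 13) ≤ M * (14 * M) := Nat.mul_le_mul (by omega) (by omega)
      _ = 14 * M ^ 2 := by ring
  have f1 : 2 * M ^ 2 ≤ M ^ 3 := by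
    calc 2 * M ^ 2 ≤ M * M ^ 2 := Nat.mul_le_mul_right _ hM2
      _ = M ^ 3 := by ring
  have f2 : 2 * M ≤ M ^ 2 := by
    calc 2 * M ≤ M * M := Nat.mul_le_mul_right _ hM2
      _ = M ^ 2 := by ring
  omega

/-- **The time polynomial** `64 (X + t(X+1) + deg t + c + 2)³`. [folklore] -/
noncomputable def timePoly (t : Polynomial ℕ) (c : ℕ) : Polynomial ℕ :=
  Polynomial.C 64 * (Polynomial.X + t.comp (Polynomial.X + 1) + Polynomial.C (t.natDegree + c + 2)) ^ 3

/-- Evaluation of the time polynomial. [folklore] -/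
theorem eval_timePoly (t : Polynomial ℕ) (c N : ℕ) :
    (timePoly t c).eval N = 64 * (N + t.eval (N + 1) + (t.natDegree + c + 2)) ^ 3 := by
  simp [timePoly, Polynomial.eval_comp]

end LPO

/-- **The preprocessing of the one-way function candidate is polynomial time**: `lpoFn t c ∈ FP`.
[cite: AroraBarakCC2009, §1.3] -/
theorem lpoFn_mem_FP (t : Polynomial ℕ) (c : ℕ) : lpoFn t c ∈ Complexity.FP :=
  Complexity.Com.mem_FP (LPO.prog t c) LPO.Rg.inp LPO.Rg.out (LPO.timePoly t c) (lpoFn t c) fun x => by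
    obtain ⟨R', h, hout⟩ := LPO.runs_prog t c x
    refine ⟨R', Or.inl (h.mono ?_), hout⟩
    rw [LPO.eval_timePoly]
    exact LPO.progCost_le t c x.length

/-- **Value of `lpoFn`** with the field width written as `Nat.size`:
`lpoFn t c x = ⟨⟨1ᴸ, x ↾ D⟩, ⟨(x ⇂ D) ↾ bitsToNat (x ↾ D), 1^{t(L - D - c)}⟩⟩`, `D = Nat.size L`,
`1ᵏ = List.replicate k true`. [Y. Liu, R. Pass, FOCS 2020, proof of Thm 4.1] [folklore] -/
theorem lpoFn_apply (t : Polynomial ℕ) (c : ℕ) (x : List Bool) :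
    lpoFn t c x =
      Complexity.boolPair (Complexity.boolPair (List.replicate x.length true) (x.take (Nat.size x.length)))
        (Complexity.boolPair ((x.drop (Nat.size x.length)).take (Complexity.bitsToNat (x.take (Nat.size x.length))))
          (List.replicate (t.eval (x.length - Nat.size x.length - c)) true)) := by
  rw [lpoFn, LPO.dOf_eq_size]

end Literature.Computability.Cryptography
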